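/-
Copyright (c) 2026 the pub-hodgecm-mathlib formalisation cell (harness21).  Prover seat hodgecm-mathlib-K2E5-p16 (g5): Track B «K2-LIT»,
hLiu418 = stmt-HodgeConjecture-24832, ROAD Φ organ Φ6b-6 (β-shift of Shimura's `η` on `Herm₂(ℂ)`), file (4b): growth of the β-shifted
`η` in `h`, uniformly on `(α, β)`-boxes (co-dealer rider (b) for the Φ6b-5 lattice M-test); 2026-09-04.
-/
import Summits.HodgeConjecture.HodgeConjecture.Theorems.K2LiuHermTwoInvMulEtaGrowth         -- (4b-i): weighted growth pieces
import HarnessLib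

/-!
# Crux `HLiu418`, ROAD Φ, organ Φ6b-6 — file (4b): growth of `etaShift(g, h; α, β)` in `h`, uniformly on `(α, β)`-boxes of `ℂ × {re β > 0}`

Cell `hodgecm-mathlib`, crux item hLiu418 = `stmt-HodgeConjecture-24832`, route of record `HCCMUnconditional`; squad K2, LEAD F0P6-plan (g12),
co-dealer K2E5-plan (g6) (rider (b) 2026-09-04 07:41:05Z: «a LOCALLY UNIFORM GROWTH BOUND IN `h` … the shifted twin of ★ `norm_xiEtaRhs_le₂` …
keep the three-factor shape, `C` h-free»), prover K2E5-p16 (g5).  THEOREMS ONLY; lane `--supports stmt-HodgeConjecture-24832 --as helper`.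

THE ESTIMATE (`norm_etaShift_le₂`).  For `g > 0`, reals `a₁ ≤ a₂`, `0 < b₁ ≤ b₂`, `M ≥ 0` there is `C ≥ 0` (h-free) such that for EVERY `h > 0` and
all `α, β` with `re α ∈ [a₁, a₂]`, `re β ∈ [b₁, b₂]`, `|α − 2| ≤ M`:
  `|etaShift(g, h; α, β)| ≤ C · e^{−Re tr(hg)} · (1 + tr h)^{2(a₂−2)⁺ + 1} · (1 + det(h)^{−((2−a₁)⁺ + 1)})`
— the three-factor shape of ★ `norm_etaTwo_le₂` with `N ↦ N + 1`, `N′ ↦ N′ + 1`: the weight `Q_α` costs `|Q_α(u+h)| ≤ A_h·u₁₁⁻¹ + B_h` with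
`A_h + B_h ≤ (|g₀₀| + M)(1 + tr h)(1 + det(h)⁻¹)` (★ `norm_etaShiftWeight_le`), and `(1 + x⁻¹)(1 + x^{−N′}) ≤ 2(1 + x^{−(N′+1)})`.
INGREDIENTS.  The WEIGHTED twins of ★ g4's pointwise∕integral bounds (file (4b-i) `K2LiuHermTwoInvMulEtaGrowth`:
`integral_norm_inv_mul_etaTwoIntegrand_add_le`), ★ g4's `integral_norm_etaTwoIntegrand_add_le`, the corner interpolation
★ `norm_etaTwoIntegrand_add_le_four` at `β + 1`, and the weight bound ★ `norm_etaShiftWeight_le`.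
HONEST LABEL.  Count-neutral helper of the K2_Liu road; it pays no socket by itself: `HC_CM` is proved only modulo the 7 printed citations
(2 remaining named inputs: hLiu418 = `stmt-HodgeConjecture-24832`, h413 = `stmt-HodgeConjecture-24833`) until rung 0 closes.
-/

set_option autoImplicit false
-- the mandated namespace repeats the single-problem summit's segment (`HodgeConjecture.HodgeConjecture`)
set_option linter.dupNamespace false

noncomputable section

open Complex MeasureTheory Set
open scoped ComplexOrder ComplexConjugate

namespace Summit.HodgeConjecture.HodgeConjecture.Cruxes.HLiu418.K2LiuHermTwoEtaShiftGrowth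

open Summit.HodgeConjecture.HodgeConjecture.Cruxes.HLiu418.K2LiuHermTwoGammaDefs
open Summit.HodgeConjecture.HodgeConjecture.Cruxes.HLiu418.K2LiuHermTwoGammaSiegelGindikin
open Summit.HodgeConjecture.HodgeConjecture.Cruxes.HLiu418.K2LiuHermTwoEtaDefs
open Summit.HodgeConjecture.HodgeConjecture.Cruxes.HLiu418.K2LiuHermTwoEtaConvergence
open Summit.HodgeConjecture.HodgeConjecture.Cruxes.HLiu418.K2LiuHermTwoEtaGrowth
open Summit.HodgeConjecture.HodgeConjecture.Cruxes.HLiu418.K2LiuHermTwoEtaGrowthUniform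
open Summit.HodgeConjecture.HodgeConjecture.Cruxes.HLiu418.K2LiuHermTwoConeInvEntryIntegrable
open Summit.HodgeConjecture.HodgeConjecture.Cruxes.HLiu418.K2LiuHermTwoEtaShiftDefs
open Summit.HodgeConjecture.HodgeConjecture.Cruxes.HLiu418.K2LiuHermTwoEtaShiftConvergence
open Summit.HodgeConjecture.HodgeConjecture.Cruxes.HLiu418.K2LiuHermTwoEtaBetaShift

open Summit.HodgeConjecture.HodgeConjecture.Cruxes.HLiu418.K2LiuHermTwoInvMulEtaGrowth

/-! ## Growth of the β-shifted `η`, uniformly on boxes -/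

/-- **GROWTH OF `etaShift(g, h; α, β)` IN `h`, UNIFORMLY ON `(α, β)`-BOXES OF `ℂ × {re β > 0}`** (co-dealer rider (b)): for `g > 0`, reals
`a₁ ≤ a₂`, `0 < b₁ ≤ b₂` and `M ≥ 0` there is `C ≥ 0` (independent of `h`) such that for every positive definite `h` and all `α, β` with
`re α ∈ [a₁, a₂]`, `re β ∈ [b₁, b₂]`, `|α − 2| ≤ M`:
  `|etaShift(g, h; α, β)| ≤ C · e^{−Re tr(hg)} · (1 + tr h)^{2(a₂−2)⁺ + 1} · (1 + det(h)^{−((2−a₁)⁺ + 1)})`. -/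
theorem norm_etaShift_le₂ {g : Matrix (Fin 2) (Fin 2) ℂ} (hg : g.PosDef) {a₁ a₂ b₁ b₂ M : ℝ} (h12 : a₁ ≤ a₂) (hb₁ : 0 < b₁) (hb12 : b₁ ≤ b₂)
    (hM : 0 ≤ M) :
    ∃ C : ℝ, 0 ≤ C ∧ ∀ h : Matrix (Fin 2) (Fin 2) ℂ, h.PosDef → ∀ α β : ℂ, a₁ ≤ α.re → α.re ≤ a₂ → b₁ ≤ β.re → β.re ≤ b₂ → ‖α - 2‖ ≤ M →
      ‖etaShift g h α β‖ ≤ C * Real.exp (-((h * g).trace).re) *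
        ((1 + ((h 0 0).re + (h 1 1).re)) ^ (2 * max (a₂ - 2) 0 + 1) *
          (1 + ((h 0 0).re * (h 1 1).re - normSq (h 0 1)) ^ (-(max (2 - a₁) 0 + 1)))) := by
  obtain ⟨d, rfl⟩ : ∃ d : ℝ × ℂ × ℝ, hermTwo d = g := ⟨_, hermTwo_eq_of_isHermitian hg.1⟩
  have hd := (posDef_hermTwo_iff d).mp hg
  have hb₂ : 0 < b₂ := lt_of_lt_of_le hb₁ hb12
  have hb₁' : 1 < ((b₁ + 1 : ℝ) : ℂ).re := by simp only [ofReal_re]; linarith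
  have hb₂' : 1 < ((b₂ + 1 : ℝ) : ℂ).re := by simp only [ofReal_re]; linarith
  -- eight h-free constants: four weighted, four plain
  obtain ⟨W₁₁, hW₁₁, hV₁₁⟩ := integral_norm_inv_mul_etaTwoIntegrand_add_le hd hb₁' a₁
  obtain ⟨W₁₂, hW₁₂, hV₁₂⟩ := integral_norm_inv_mul_etaTwoIntegrand_add_le hd hb₂' a₁
  obtain ⟨W₂₁, hW₂₁, hV₂₁⟩ := integral_norm_inv_mul_etaTwoIntegrand_add_le hd hb₁' a₂
  obtain ⟨W₂₂, hW₂₂, hV₂₂⟩ := integral_norm_inv_mul_etaTwoIntegrand_add_le hd hb₂' a₂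
  obtain ⟨C₁₁, hC₁₁, hB₁₁⟩ := integral_norm_etaTwoIntegrand_add_le hd hb₁' a₁
  obtain ⟨C₁₂, hC₁₂, hB₁₂⟩ := integral_norm_etaTwoIntegrand_add_le hd hb₂' a₁
  obtain ⟨C₂₁, hC₂₁, hB₂₁⟩ := integral_norm_etaTwoIntegrand_add_le hd hb₁' a₂
  obtain ⟨C₂₂, hC₂₂, hB₂₂⟩ := integral_norm_etaTwoIntegrand_add_le hd hb₂' a₂
  set S : ℝ := ((W₁₁ + W₁₂) + (W₂₁ + W₂₂)) + ((C₁₁ + C₁₂) + (C₂₁ + C₂₂)) with hS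
  have hS0 : 0 ≤ S := by positivity
  refine ⟨2 * ((‖hermTwo d 0 0‖ + M) * S), by positivity, fun h hh α β hα₁ hα₂ hβ₁ hβ₂ hαM => ?_⟩
  obtain ⟨e, rfl⟩ : ∃ e : ℝ × ℂ × ℝ, hermTwo e = h := ⟨_, hermTwo_eq_of_isHermitian hh.1⟩
  have heh := (posDef_hermTwo_iff e).mp hh
  have he1 : 0 < e.1 := heh.1
  have he2 : 0 < e.2.2 := snd_pos_of_cone heh.1 heh.2
  have hδ : 0 < e.1 * e.2.2 - normSq e.2.1 := by linarith [heh.2]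
  have hβ : 0 < β.re := lt_of_lt_of_le hb₁ hβ₁
  have hβ1 : 1 < (β + 1).re := by simp only [add_re, one_re]; linarith
  have hβ₁' : b₁ + 1 ≤ (β + 1).re := by simp only [add_re, one_re]; linarith
  have hβ₂' : (β + 1).re ≤ b₂ + 1 := by simp only [add_re, one_re]; linarith
  simp only [trace_hermTwo_mul_hermTwo, hermTwo_apply_zero_zero, hermTwo_apply_one_one, hermTwo_apply_zero_one, ofReal_re]
  -- the weight's constants for this `h`: `|Q_α(u + h)| ≤ A u₁₁⁻¹ + B`
  have h2e := (posDef_hermTwo_iff (e + e)).mp (by rw [hermTwo_add]; exact hh.add hh)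
  set δ₂ : ℝ := (e + e).1 * (e + e).2.2 - normSq (e + e).2.1 with hδ₂def
  have hδ₂ : δ₂ = 4 * (e.1 * e.2.2 - normSq e.2.1) := by
    rw [hδ₂def]
    simp only [Prod.fst_add, Prod.snd_add]
    rw [show e.2.1 + e.2.1 = (2 : ℂ) * e.2.1 by ring, map_mul, show normSq (2 : ℂ) = 4 by norm_num [normSq_apply]]
    ring
  have hδ₂pos : 0 < δ₂ := by rw [hδ₂]; positivity
  set A : ℝ := ‖hermTwo d 0 0‖ + 2 * e.2.2 * M / δ₂ with hA
  set B : ℝ := M / δ₂ with hB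
  have hA0 : 0 ≤ A := by positivity
  have hB0 : 0 ≤ B := by positivity
  -- `|etaShift| ≤ ∫ |shift-int(u + h)| ≤ A Σ weighted corners + B Σ corners`
  have hI := (integrableOn_etaShiftIntegrand_comp_add hg hh α hβ).norm
  have hJ₁₁ := (integrableOn_inv_mul_etaTwoIntegrand_comp_add hg hh (a₁ : ℂ) hb₁').norm
  have hJ₁₂ := (integrableOn_inv_mul_etaTwoIntegrand_comp_add hg hh (a₁ : ℂ) hb₂').norm
  have hJ₂₁ := (integrableOn_inv_mul_etaTwoIntegrand_comp_add hg hh (a₂ : ℂ) hb₁').norm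
  have hJ₂₂ := (integrableOn_inv_mul_etaTwoIntegrand_comp_add hg hh (a₂ : ℂ) hb₂').norm
  have hI₁₁ := (integrableOn_etaTwoIntegrand_comp_add hg hh (a₁ : ℂ) hb₁').norm
  have hI₁₂ := (integrableOn_etaTwoIntegrand_comp_add hg hh (a₁ : ℂ) hb₂').norm
  have hI₂₁ := (integrableOn_etaTwoIntegrand_comp_add hg hh (a₂ : ℂ) hb₁').norm
  have hI₂₂ := (integrableOn_etaTwoIntegrand_comp_add hg hh (a₂ : ℂ) hb₂').norm
  have step1 : ‖etaShift (hermTwo d) (hermTwo e) α β‖ ≤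
      ∫ u in {c : ℝ × ℂ × ℝ | (hermTwo c).PosDef}, ‖etaShiftIntegrand (hermTwo d) (hermTwo e) α β (u + e)‖ := by
    rw [etaShift_eq_integral_comp_add (hermTwo d) hh.posSemidef]
    exact norm_integral_le_integral_norm _
  have hJa : Integrable (fun u : ℝ × ℂ × ℝ =>
      (‖((hermTwo (u + e) - hermTwo e) 1 1)⁻¹ * etaTwoIntegrand (hermTwo d) (hermTwo e) (a₁ : ℂ) ((b₁ + 1 : ℝ) : ℂ) (u + e)‖ +
        ‖((hermTwo (u + e) - hermTwo e) 1 1)⁻¹ * etaTwoIntegrand (hermTwo d) (hermTwo e) (a₁ : ℂ) ((b₂ + 1 : ℝ) : ℂ) (u + e)‖) +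
      (‖((hermTwo (u + e) - hermTwo e) 1 1)⁻¹ * etaTwoIntegrand (hermTwo d) (hermTwo e) (a₂ : ℂ) ((b₁ + 1 : ℝ) : ℂ) (u + e)‖ +
        ‖((hermTwo (u + e) - hermTwo e) 1 1)⁻¹ * etaTwoIntegrand (hermTwo d) (hermTwo e) (a₂ : ℂ) ((b₂ + 1 : ℝ) : ℂ) (u + e)‖))
      (volume.restrict {c : ℝ × ℂ × ℝ | (hermTwo c).PosDef}) := (hJ₁₁.add hJ₁₂).add (hJ₂₁.add hJ₂₂)
  have hIa : Integrable (fun u : ℝ × ℂ × ℝ =>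
      (‖etaTwoIntegrand (hermTwo d) (hermTwo e) (a₁ : ℂ) ((b₁ + 1 : ℝ) : ℂ) (u + e)‖ +
        ‖etaTwoIntegrand (hermTwo d) (hermTwo e) (a₁ : ℂ) ((b₂ + 1 : ℝ) : ℂ) (u + e)‖) +
      (‖etaTwoIntegrand (hermTwo d) (hermTwo e) (a₂ : ℂ) ((b₁ + 1 : ℝ) : ℂ) (u + e)‖ +
        ‖etaTwoIntegrand (hermTwo d) (hermTwo e) (a₂ : ℂ) ((b₂ + 1 : ℝ) : ℂ) (u + e)‖))
      (volume.restrict {c : ℝ × ℂ × ℝ | (hermTwo c).PosDef}) := (hI₁₁.add hI₁₂).add (hI₂₁.add hI₂₂)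
  have hJ₁ : Integrable (fun u : ℝ × ℂ × ℝ =>
      ‖((hermTwo (u + e) - hermTwo e) 1 1)⁻¹ * etaTwoIntegrand (hermTwo d) (hermTwo e) (a₁ : ℂ) ((b₁ + 1 : ℝ) : ℂ) (u + e)‖ +
        ‖((hermTwo (u + e) - hermTwo e) 1 1)⁻¹ * etaTwoIntegrand (hermTwo d) (hermTwo e) (a₁ : ℂ) ((b₂ + 1 : ℝ) : ℂ) (u + e)‖)
      (volume.restrict {c : ℝ × ℂ × ℝ | (hermTwo c).PosDef}) := hJ₁₁.add hJ₁₂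
  have hJ₂ : Integrable (fun u : ℝ × ℂ × ℝ =>
      ‖((hermTwo (u + e) - hermTwo e) 1 1)⁻¹ * etaTwoIntegrand (hermTwo d) (hermTwo e) (a₂ : ℂ) ((b₁ + 1 : ℝ) : ℂ) (u + e)‖ +
        ‖((hermTwo (u + e) - hermTwo e) 1 1)⁻¹ * etaTwoIntegrand (hermTwo d) (hermTwo e) (a₂ : ℂ) ((b₂ + 1 : ℝ) : ℂ) (u + e)‖)
      (volume.restrict {c : ℝ × ℂ × ℝ | (hermTwo c).PosDef}) := hJ₂₁.add hJ₂₂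
  have hI₁ : Integrable (fun u : ℝ × ℂ × ℝ =>
      ‖etaTwoIntegrand (hermTwo d) (hermTwo e) (a₁ : ℂ) ((b₁ + 1 : ℝ) : ℂ) (u + e)‖ +
        ‖etaTwoIntegrand (hermTwo d) (hermTwo e) (a₁ : ℂ) ((b₂ + 1 : ℝ) : ℂ) (u + e)‖)
      (volume.restrict {c : ℝ × ℂ × ℝ | (hermTwo c).PosDef}) := hI₁₁.add hI₁₂
  have hI₂ : Integrable (fun u : ℝ × ℂ × ℝ =>
      ‖etaTwoIntegrand (hermTwo d) (hermTwo e) (a₂ : ℂ) ((b₁ + 1 : ℝ) : ℂ) (u + e)‖ +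
        ‖etaTwoIntegrand (hermTwo d) (hermTwo e) (a₂ : ℂ) ((b₂ + 1 : ℝ) : ℂ) (u + e)‖)
      (volume.restrict {c : ℝ × ℂ × ℝ | (hermTwo c).PosDef}) := hI₂₁.add hI₂₂
  have hJA : Integrable (fun u : ℝ × ℂ × ℝ => A *
      ((‖((hermTwo (u + e) - hermTwo e) 1 1)⁻¹ * etaTwoIntegrand (hermTwo d) (hermTwo e) (a₁ : ℂ) ((b₁ + 1 : ℝ) : ℂ) (u + e)‖ +
        ‖((hermTwo (u + e) - hermTwo e) 1 1)⁻¹ * etaTwoIntegrand (hermTwo d) (hermTwo e) (a₁ : ℂ) ((b₂ + 1 : ℝ) : ℂ) (u + e)‖) +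
      (‖((hermTwo (u + e) - hermTwo e) 1 1)⁻¹ * etaTwoIntegrand (hermTwo d) (hermTwo e) (a₂ : ℂ) ((b₁ + 1 : ℝ) : ℂ) (u + e)‖ +
        ‖((hermTwo (u + e) - hermTwo e) 1 1)⁻¹ * etaTwoIntegrand (hermTwo d) (hermTwo e) (a₂ : ℂ) ((b₂ + 1 : ℝ) : ℂ) (u + e)‖)))
      (volume.restrict {c : ℝ × ℂ × ℝ | (hermTwo c).PosDef}) := hJa.const_mul A
  have hIB : Integrable (fun u : ℝ × ℂ × ℝ => B *
      ((‖etaTwoIntegrand (hermTwo d) (hermTwo e) (a₁ : ℂ) ((b₁ + 1 : ℝ) : ℂ) (u + e)‖ +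
        ‖etaTwoIntegrand (hermTwo d) (hermTwo e) (a₁ : ℂ) ((b₂ + 1 : ℝ) : ℂ) (u + e)‖) +
      (‖etaTwoIntegrand (hermTwo d) (hermTwo e) (a₂ : ℂ) ((b₁ + 1 : ℝ) : ℂ) (u + e)‖ +
        ‖etaTwoIntegrand (hermTwo d) (hermTwo e) (a₂ : ℂ) ((b₂ + 1 : ℝ) : ℂ) (u + e)‖)))
      (volume.restrict {c : ℝ × ℂ × ℝ | (hermTwo c).PosDef}) := hIa.const_mul B
  have step2 : ∫ u in {c : ℝ × ℂ × ℝ | (hermTwo c).PosDef}, ‖etaShiftIntegrand (hermTwo d) (hermTwo e) α β (u + e)‖ ≤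
      ∫ u in {c : ℝ × ℂ × ℝ | (hermTwo c).PosDef},
        (A * ((‖((hermTwo (u + e) - hermTwo e) 1 1)⁻¹ * etaTwoIntegrand (hermTwo d) (hermTwo e) (a₁ : ℂ) ((b₁ + 1 : ℝ) : ℂ) (u + e)‖ +
            ‖((hermTwo (u + e) - hermTwo e) 1 1)⁻¹ * etaTwoIntegrand (hermTwo d) (hermTwo e) (a₁ : ℂ) ((b₂ + 1 : ℝ) : ℂ) (u + e)‖) +
          (‖((hermTwo (u + e) - hermTwo e) 1 1)⁻¹ * etaTwoIntegrand (hermTwo d) (hermTwo e) (a₂ : ℂ) ((b₁ + 1 : ℝ) : ℂ) (u + e)‖ +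
            ‖((hermTwo (u + e) - hermTwo e) 1 1)⁻¹ * etaTwoIntegrand (hermTwo d) (hermTwo e) (a₂ : ℂ) ((b₂ + 1 : ℝ) : ℂ) (u + e)‖)) +
        B * ((‖etaTwoIntegrand (hermTwo d) (hermTwo e) (a₁ : ℂ) ((b₁ + 1 : ℝ) : ℂ) (u + e)‖ +
            ‖etaTwoIntegrand (hermTwo d) (hermTwo e) (a₁ : ℂ) ((b₂ + 1 : ℝ) : ℂ) (u + e)‖) +
          (‖etaTwoIntegrand (hermTwo d) (hermTwo e) (a₂ : ℂ) ((b₁ + 1 : ℝ) : ℂ) (u + e)‖ +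
            ‖etaTwoIntegrand (hermTwo d) (hermTwo e) (a₂ : ℂ) ((b₂ + 1 : ℝ) : ℂ) (u + e)‖))) := by
    refine setIntegral_mono_on hI (hJA.add hIB) measurableSet_posDef_hermTwo fun u hu => ?_
    have hu' := (posDef_hermTwo_iff u).mp hu
    have hy : 0 < u.2.2 := snd_pos_of_cone hu'.1 hu'.2
    have hcm : (hermTwo (u + e) - hermTwo e).PosDef := by rwa [hermTwo_add, add_sub_cancel_right]
    have hW := norm_etaShiftWeight_le (hermTwo d) hh hcm α
    rw [← hδ₂def, show (u + e).2.2 - e.2.2 = u.2.2 by simp [Prod.snd_add]] at hW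
    have hQ : ‖etaShiftWeight (hermTwo d) (hermTwo e) α (u + e)‖ ≤ A * u.2.2⁻¹ + B := by
      refine hW.trans ?_
      rw [hA, hB]
      have h1 : ‖hermTwo d 0 0‖ + 2 * e.2.2 * ‖α - 2‖ / δ₂ ≤ ‖hermTwo d 0 0‖ + 2 * e.2.2 * M / δ₂ := by gcongr
      have h2 : ‖α - 2‖ / δ₂ ≤ M / δ₂ := by gcongr
      exact add_le_add (mul_le_mul_of_nonneg_right h1 (inv_nonneg.mpr hy.le)) h2
    have hfour := norm_etaTwoIntegrand_add_le_four d hh hu (γ := α) (β := β + 1) hα₁ hα₂ hβ₁' hβ₂'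
    rw [etaShiftIntegrand_apply, norm_mul]
    simp only [norm_inv_mul_etaTwoIntegrand_add _ e hu]
    have hF0 : 0 ≤ (‖etaTwoIntegrand (hermTwo d) (hermTwo e) (a₁ : ℂ) ((b₁ + 1 : ℝ) : ℂ) (u + e)‖ +
        ‖etaTwoIntegrand (hermTwo d) (hermTwo e) (a₁ : ℂ) ((b₂ + 1 : ℝ) : ℂ) (u + e)‖) +
      (‖etaTwoIntegrand (hermTwo d) (hermTwo e) (a₂ : ℂ) ((b₁ + 1 : ℝ) : ℂ) (u + e)‖ +
        ‖etaTwoIntegrand (hermTwo d) (hermTwo e) (a₂ : ℂ) ((b₂ + 1 : ℝ) : ℂ) (u + e)‖) := by positivity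
    calc ‖etaShiftWeight (hermTwo d) (hermTwo e) α (u + e)‖ * ‖etaTwoIntegrand (hermTwo d) (hermTwo e) α (β + 1) (u + e)‖
        ≤ (A * u.2.2⁻¹ + B) * ((‖etaTwoIntegrand (hermTwo d) (hermTwo e) (a₁ : ℂ) ((b₁ + 1 : ℝ) : ℂ) (u + e)‖ +
            ‖etaTwoIntegrand (hermTwo d) (hermTwo e) (a₁ : ℂ) ((b₂ + 1 : ℝ) : ℂ) (u + e)‖) +
          (‖etaTwoIntegrand (hermTwo d) (hermTwo e) (a₂ : ℂ) ((b₁ + 1 : ℝ) : ℂ) (u + e)‖ +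
            ‖etaTwoIntegrand (hermTwo d) (hermTwo e) (a₂ : ℂ) ((b₂ + 1 : ℝ) : ℂ) (u + e)‖)) :=
          mul_le_mul hQ hfour (norm_nonneg _) (add_nonneg (mul_nonneg hA0 (inv_nonneg.mpr hy.le)) hB0)
      _ = _ := by ring
  rw [integral_add hJA hIB, integral_const_mul, integral_const_mul, integral_add hJ₁ hJ₂, integral_add hJ₁₁ hJ₁₂, integral_add hJ₂₁ hJ₂₂,
    integral_add hI₁ hI₂, integral_add hI₁₁ hI₁₂, integral_add hI₂₁ hI₂₂] at step2
  have hV₁₁' := hV₁₁ e hh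
  have hV₁₂' := hV₁₂ e hh
  have hV₂₁' := hV₂₁ e hh
  have hV₂₂' := hV₂₂ e hh
  have hB₁₁' := hB₁₁ e hh
  have hB₁₂' := hB₁₂ e hh
  have hB₂₁' := hB₂₁ e hh
  have hB₂₂' := hB₂₂ e hh
  -- monotonicity of the profile factors in the exponents (as in ★ `norm_etaTwo_le₂`)
  set N₀ : ℝ := 2 * max (a₂ - 2) 0 with hN₀
  set N₀' : ℝ := max (2 - a₁) 0 with hN₀'
  have hN₀0 : 0 ≤ N₀ := by positivity
  have hN₀'0 : 0 ≤ N₀' := le_max_right _ _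
  have hE : (1 : ℝ) ≤ 1 + (e.1 + e.2.2) := by linarith
  have hP : 0 ≤ (1 + (e.1 + e.2.2)) ^ N₀ := Real.rpow_nonneg (by linarith) _
  have hm₁ : (1 + (e.1 + e.2.2)) ^ (2 * max (a₁ - 2) 0) ≤ (1 + (e.1 + e.2.2)) ^ N₀ :=
    Real.rpow_le_rpow_of_exponent_le hE (by rw [hN₀]; linarith [max_le_max (sub_le_sub_right h12 2) (le_refl (0 : ℝ))])
  have hn₁ : (e.1 * e.2.2 - normSq e.2.1) ^ (-max (2 - a₁) 0) ≤ 1 + (e.1 * e.2.2 - normSq e.2.1) ^ (-N₀') := by rw [hN₀']; linarith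
  have hn₂ : (e.1 * e.2.2 - normSq e.2.1) ^ (-max (2 - a₂) 0) ≤ 1 + (e.1 * e.2.2 - normSq e.2.1) ^ (-N₀') := by
    have h := Literature.Dynamics.TransferOperators.rpow_neg_le_add (a := max (2 - a₂) 0) (a₁ := 0) (a₂ := max (2 - a₁) 0) hδ
      (le_max_right _ _) (max_le_max (by linarith) (le_refl (0 : ℝ)))
    rwa [neg_zero, Real.rpow_zero] at h
  have key₁ : (1 + (e.1 + e.2.2)) ^ (2 * max (a₁ - 2) 0) * (e.1 * e.2.2 - normSq e.2.1) ^ (-max (2 - a₁) 0) ≤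
      (1 + (e.1 + e.2.2)) ^ N₀ * (1 + (e.1 * e.2.2 - normSq e.2.1) ^ (-N₀')) :=
    mul_le_mul hm₁ hn₁ (Real.rpow_nonneg hδ.le _) hP
  have key₂ : (1 + (e.1 + e.2.2)) ^ (2 * max (a₂ - 2) 0) * (e.1 * e.2.2 - normSq e.2.1) ^ (-max (2 - a₂) 0) ≤
      (1 + (e.1 + e.2.2)) ^ N₀ * (1 + (e.1 * e.2.2 - normSq e.2.1) ^ (-N₀')) :=
    mul_le_mul_of_nonneg_left hn₂ hP
  set X : ℝ := Real.exp (-(e.1 * d.1 + e.2.2 * d.2.2 + 2 * (e.2.1 * conj d.2.1).re)) with hXdef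
  have hX0 : 0 ≤ X := (Real.exp_pos _).le
  set F : ℝ := (1 + (e.1 + e.2.2)) ^ N₀ * (1 + (e.1 * e.2.2 - normSq e.2.1) ^ (-N₀')) with hFdef
  have hF0 : 0 ≤ F := by positivity
  have hY₁₁ := mul_le_mul_of_nonneg_left key₁ (mul_nonneg hW₁₁ hX0)
  have hY₁₂ := mul_le_mul_of_nonneg_left key₁ (mul_nonneg hW₁₂ hX0)
  have hY₂₁ := mul_le_mul_of_nonneg_left key₂ (mul_nonneg hW₂₁ hX0)
  have hY₂₂ := mul_le_mul_of_nonneg_left key₂ (mul_nonneg hW₂₂ hX0)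
  have hX₁₁ := mul_le_mul_of_nonneg_left key₁ (mul_nonneg hC₁₁ hX0)
  have hX₁₂ := mul_le_mul_of_nonneg_left key₁ (mul_nonneg hC₁₂ hX0)
  have hX₂₁ := mul_le_mul_of_nonneg_left key₂ (mul_nonneg hC₂₁ hX0)
  have hX₂₂ := mul_le_mul_of_nonneg_left key₂ (mul_nonneg hC₂₂ hX0)
  -- hence `|etaShift| ≤ (A + B) · S · X · F`
  have hWs : 0 ≤ (W₁₁ + W₁₂) + (W₂₁ + W₂₂) := by positivity
  have hCs : 0 ≤ (C₁₁ + C₁₂) + (C₂₁ + C₂₂) := by positivity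
  have h0 : A * ((W₁₁ + W₁₂) + (W₂₁ + W₂₂)) + B * ((C₁₁ + C₁₂) + (C₂₁ + C₂₂)) ≤ (A + B) * S := by
    have hexp : (A + B) * S = A * ((W₁₁ + W₁₂) + (W₂₁ + W₂₂)) + B * ((C₁₁ + C₁₂) + (C₂₁ + C₂₂)) +
        (A * ((C₁₁ + C₁₂) + (C₂₁ + C₂₂)) + B * ((W₁₁ + W₁₂) + (W₂₁ + W₂₂))) := by
      rw [hS]
      ring
    rw [hexp]
    have h3 := mul_nonneg hA0 hCs
    have h4 := mul_nonneg hB0 hWs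
    linarith
  have hJsum : ((∫ u in {c : ℝ × ℂ × ℝ | (hermTwo c).PosDef},
        ‖((hermTwo (u + e) - hermTwo e) 1 1)⁻¹ * etaTwoIntegrand (hermTwo d) (hermTwo e) (a₁ : ℂ) ((b₁ + 1 : ℝ) : ℂ) (u + e)‖) +
      (∫ u in {c : ℝ × ℂ × ℝ | (hermTwo c).PosDef},
        ‖((hermTwo (u + e) - hermTwo e) 1 1)⁻¹ * etaTwoIntegrand (hermTwo d) (hermTwo e) (a₁ : ℂ) ((b₂ + 1 : ℝ) : ℂ) (u + e)‖)) +
      ((∫ u in {c : ℝ × ℂ × ℝ | (hermTwo c).PosDef},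
        ‖((hermTwo (u + e) - hermTwo e) 1 1)⁻¹ * etaTwoIntegrand (hermTwo d) (hermTwo e) (a₂ : ℂ) ((b₁ + 1 : ℝ) : ℂ) (u + e)‖) +
      (∫ u in {c : ℝ × ℂ × ℝ | (hermTwo c).PosDef},
        ‖((hermTwo (u + e) - hermTwo e) 1 1)⁻¹ * etaTwoIntegrand (hermTwo d) (hermTwo e) (a₂ : ℂ) ((b₂ + 1 : ℝ) : ℂ) (u + e)‖)) ≤
      (W₁₁ * X * F + W₁₂ * X * F) + (W₂₁ * X * F + W₂₂ * X * F) :=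
    add_le_add (add_le_add (hV₁₁'.trans hY₁₁) (hV₁₂'.trans hY₁₂)) (add_le_add (hV₂₁'.trans hY₂₁) (hV₂₂'.trans hY₂₂))
  have hIsum : ((∫ u in {c : ℝ × ℂ × ℝ | (hermTwo c).PosDef}, ‖etaTwoIntegrand (hermTwo d) (hermTwo e) (a₁ : ℂ) ((b₁ + 1 : ℝ) : ℂ) (u + e)‖) +
      (∫ u in {c : ℝ × ℂ × ℝ | (hermTwo c).PosDef}, ‖etaTwoIntegrand (hermTwo d) (hermTwo e) (a₁ : ℂ) ((b₂ + 1 : ℝ) : ℂ) (u + e)‖)) +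
      ((∫ u in {c : ℝ × ℂ × ℝ | (hermTwo c).PosDef}, ‖etaTwoIntegrand (hermTwo d) (hermTwo e) (a₂ : ℂ) ((b₁ + 1 : ℝ) : ℂ) (u + e)‖) +
      (∫ u in {c : ℝ × ℂ × ℝ | (hermTwo c).PosDef}, ‖etaTwoIntegrand (hermTwo d) (hermTwo e) (a₂ : ℂ) ((b₂ + 1 : ℝ) : ℂ) (u + e)‖)) ≤
      (C₁₁ * X * F + C₁₂ * X * F) + (C₂₁ * X * F + C₂₂ * X * F) :=
    add_le_add (add_le_add (hB₁₁'.trans hX₁₁) (hB₁₂'.trans hX₁₂)) (add_le_add (hB₂₁'.trans hX₂₁) (hB₂₂'.trans hX₂₂))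
  have hsum : ‖etaShift (hermTwo d) (hermTwo e) α β‖ ≤ (A + B) * S * (X * F) := by
    refine step1.trans (step2.trans ?_)
    refine (add_le_add (mul_le_mul_of_nonneg_left hJsum hA0) (mul_le_mul_of_nonneg_left hIsum hB0)).trans ?_
    calc A * ((W₁₁ * X * F + W₁₂ * X * F) + (W₂₁ * X * F + W₂₂ * X * F)) + B * ((C₁₁ * X * F + C₁₂ * X * F) + (C₂₁ * X * F + C₂₂ * X * F))
        = (A * ((W₁₁ + W₁₂) + (W₂₁ + W₂₂)) + B * ((C₁₁ + C₁₂) + (C₂₁ + C₂₂))) * (X * F) := by ring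
      _ ≤ (A + B) * S * (X * F) := mul_le_mul_of_nonneg_right h0 (mul_nonneg hX0 hF0)
  -- and `A + B ≤ (|g₀₀| + M)(1 + tr h)(1 + det(h)⁻¹)`
  have hAB : A + B ≤ (‖hermTwo d 0 0‖ + M) * ((1 + (e.1 + e.2.2)) * (1 + (e.1 * e.2.2 - normSq e.2.1)⁻¹)) := by
    rw [hA, hB, hδ₂]
    have hg00 : 0 ≤ ‖hermTwo d 0 0‖ := norm_nonneg _
    have hinv : 0 ≤ (e.1 * e.2.2 - normSq e.2.1)⁻¹ := inv_nonneg.mpr hδ.le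
    have h1 : 2 * e.2.2 * M / (4 * (e.1 * e.2.2 - normSq e.2.1)) + M / (4 * (e.1 * e.2.2 - normSq e.2.1)) =
        M * ((2 * e.2.2 + 1) / 4) * (e.1 * e.2.2 - normSq e.2.1)⁻¹ := by
      field_simp
    have h2 : (2 * e.2.2 + 1) / 4 ≤ 1 + (e.1 + e.2.2) := by linarith
    calc ‖hermTwo d 0 0‖ + 2 * e.2.2 * M / (4 * (e.1 * e.2.2 - normSq e.2.1)) + M / (4 * (e.1 * e.2.2 - normSq e.2.1))
        = ‖hermTwo d 0 0‖ + M * ((2 * e.2.2 + 1) / 4) * (e.1 * e.2.2 - normSq e.2.1)⁻¹ := by rw [add_assoc, h1]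
      _ ≤ ‖hermTwo d 0 0‖ * ((1 + (e.1 + e.2.2)) * (1 + (e.1 * e.2.2 - normSq e.2.1)⁻¹)) +
            M * (1 + (e.1 + e.2.2)) * (e.1 * e.2.2 - normSq e.2.1)⁻¹ := by
          have h3 : ‖hermTwo d 0 0‖ ≤ ‖hermTwo d 0 0‖ * ((1 + (e.1 + e.2.2)) * (1 + (e.1 * e.2.2 - normSq e.2.1)⁻¹)) :=
            le_mul_of_one_le_right hg00 (one_le_mul_of_one_le_of_one_le (by linarith) (by linarith))
          have h4 : M * ((2 * e.2.2 + 1) / 4) * (e.1 * e.2.2 - normSq e.2.1)⁻¹ ≤ M * (1 + (e.1 + e.2.2)) * (e.1 * e.2.2 - normSq e.2.1)⁻¹ :=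
            mul_le_mul_of_nonneg_right (mul_le_mul_of_nonneg_left h2 hM) hinv
          linarith
      _ ≤ (‖hermTwo d 0 0‖ + M) * ((1 + (e.1 + e.2.2)) * (1 + (e.1 * e.2.2 - normSq e.2.1)⁻¹)) := by
          have hexp : (‖hermTwo d 0 0‖ + M) * ((1 + (e.1 + e.2.2)) * (1 + (e.1 * e.2.2 - normSq e.2.1)⁻¹)) =
              ‖hermTwo d 0 0‖ * ((1 + (e.1 + e.2.2)) * (1 + (e.1 * e.2.2 - normSq e.2.1)⁻¹)) +
                M * (1 + (e.1 + e.2.2)) * (e.1 * e.2.2 - normSq e.2.1)⁻¹ + M * (1 + (e.1 + e.2.2)) := by ring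
          rw [hexp]
          have h5 : 0 ≤ M * (1 + (e.1 + e.2.2)) := mul_nonneg hM (by linarith)
          linarith
  -- assemble the three-factor shape
  have hshape : (1 + (e.1 + e.2.2)) * (1 + (e.1 * e.2.2 - normSq e.2.1)⁻¹) * F ≤
      2 * ((1 + (e.1 + e.2.2)) ^ (N₀ + 1) * (1 + (e.1 * e.2.2 - normSq e.2.1) ^ (-(N₀' + 1)))) := by
    rw [hFdef, ← one_add_rpow_mul_one_add (by linarith : (0 : ℝ) ≤ e.1 + e.2.2)]
    have h := one_add_inv_mul_one_add_rpow_neg_le hδ hN₀'0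
    have hP1 : 0 ≤ (1 + (e.1 + e.2.2)) ^ N₀ * (1 + (e.1 + e.2.2)) := mul_nonneg hP (by linarith)
    calc (1 + (e.1 + e.2.2)) * (1 + (e.1 * e.2.2 - normSq e.2.1)⁻¹) * ((1 + (e.1 + e.2.2)) ^ N₀ * (1 + (e.1 * e.2.2 - normSq e.2.1) ^ (-N₀')))
        = ((1 + (e.1 + e.2.2)) ^ N₀ * (1 + (e.1 + e.2.2))) * ((1 + (e.1 * e.2.2 - normSq e.2.1)⁻¹) * (1 + (e.1 * e.2.2 - normSq e.2.1) ^ (-N₀'))) := by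
          ring
      _ ≤ ((1 + (e.1 + e.2.2)) ^ N₀ * (1 + (e.1 + e.2.2))) * (2 * (1 + (e.1 * e.2.2 - normSq e.2.1) ^ (-(N₀' + 1)))) :=
          mul_le_mul_of_nonneg_left h hP1
      _ = _ := by ring
  calc ‖etaShift (hermTwo d) (hermTwo e) α β‖ ≤ (A + B) * S * (X * F) := hsum
    _ ≤ (‖hermTwo d 0 0‖ + M) * ((1 + (e.1 + e.2.2)) * (1 + (e.1 * e.2.2 - normSq e.2.1)⁻¹)) * S * (X * F) := by gcongr
    _ = (‖hermTwo d 0 0‖ + M) * S * X * ((1 + (e.1 + e.2.2)) * (1 + (e.1 * e.2.2 - normSq e.2.1)⁻¹) * F) := by ring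
    _ ≤ (‖hermTwo d 0 0‖ + M) * S * X * (2 * ((1 + (e.1 + e.2.2)) ^ (N₀ + 1) * (1 + (e.1 * e.2.2 - normSq e.2.1) ^ (-(N₀' + 1))))) :=
        mul_le_mul_of_nonneg_left hshape (by positivity)
    _ = 2 * ((‖hermTwo d 0 0‖ + M) * S) * X * ((1 + (e.1 + e.2.2)) ^ (N₀ + 1) * (1 + (e.1 * e.2.2 - normSq e.2.1) ^ (-(N₀' + 1)))) := by
        ring

end Summit.HodgeConjecture.HodgeConjecture.Cruxes.HLiu418.K2LiuHermTwoEtaShiftGrowth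

end
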